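import Summits.ABC.IUTFork.Cor312LicenceTripleHullCellRefuteTameSharp
import Summits.ABC.IUTFork.Conditional.AbcOfSGenuineMTameRobust
import HarnessLib

/-!
# The hull licence at the M-LEVEL setting of the OWN ideles of an abc-triple datum REFUTED from failing hull cells at a tame pole —
# the M twin of the «W:REF-BANDS-EXACT» hull-cell engine (pinned and class-robust forms)

PROOF-ONLY file (D-0012; 0 definitions, 0 `Prop` facts, no instance) of the abc-iut cell — D-0079 RESCUE sub-cell R-W «WINDOW Θ-SIDE
INEQUALITY», seat abc-iut-W-neg-1 (gen 6), row «W:REF-EXACT-M-TWIN» (the residue of `plan/rescue/R-W/M-TWIN-GAP.tsv`: the exact REFUTED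
levels / bands of the K line decided by the HULL-CELL engine had no M twin, the M line having explicit-depth / rad / LIN / tame-robust refuters
only). TAKES NO SIDE on [IUTchIII] Cor. 3.12 (S. Mochizuki, *Inter-universal Teichmüller theory III*, Cor. 3.12 p. 173–174; Step (xi-f) p. 184)
or on any author; «refuted as typed» ≠ «refuted in print».

THE K ENGINE (BY NAME): abc-iut-w5-d009's pinned socket `WRow.not_licence_triple_of_not_hullCell` (p493429) over abc-iut-rh-typ-4's
`RH.HullThresholdExactRefute.not_licence_settingPrVolSharp_of_not_hullCell` (p462895), and this seat's class-robust forms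
`WRow.not_licence_triple_of_hullCells_tame` (p496736) / `…_tameSharp` (p498814). THIS FILE is their twin at abc-iut-s2-p8's summand-route M-LEVEL
sharp setting `settingPrVolSharpM T.D … (tOfIdeleData T.D r) (tqM … r) …` of the datum's OWN ideles (the setting of the M books of record), through
abc-iut-w5-d166's ONE-MEMBER ORDERS REFUTER `not_licence_settingPrVolSharpM_tOfIdeleData_of_orders` (p467871; exact different, EXACT inner/outer
radii `‖cin‖ = ‖ϖ‖^{R_in}`, `‖cout‖ = ‖ϖ‖^{R_out}` of `log_p(𝒪^×_{K_{x₀}})`, integer q-order `‖t_{q,x₀}‖ = ‖ϖ‖^{m_q}`). R-H row 4's column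
`HullCell e m j r_in r_out :⟺ e·⌊(j²m − j(e−1) − (j+1)r_in)/e⌋ ≤ m − (j+1)r_out` (abc-iut-rh-typ-4) is that orders test with the exact radii replaced by
the certified bounds `R_in ≤ ⌊e/(p−1)⌋ + 1` (`HexHullThreshold.rpow_le_norm_of_innerRadius`) and `R_out ≥ p^{a₀} − a₀·e` at the turning point
(`HexHullThreshold.norm_le_rpow_of_mem_logUnits_turning`), to which the test is MONOTONE (§0); the exact radii EXIST in the genuine carrier
`K_{x₀} = kOfM …` (`HexHullThreshold.exists_innerRadius` / `exists_outerRadius`); at a BAD member (`placeModOfM_mem_S_and_norm_tqM_le_of_ratPoint`,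
the (P5) choice) `2l·m_q = −e·ord_p j(a/c) = 2e·v_p(abc)` (`two_mul_l_mul_order_tqM_eq_of_j_eq`, `Cor22.ord_jInv_ratPoint_triple_eq`), so `m_q = P`;
the tame different is `(e−1)/e` (`differentOrd_eq_of_not_dvd`); the type of a member is that of the K-fibre point on the same place of `K`
(abc-iut-C-cert-2's transfer: `fibreEquivPlacesOver`, `absRamificationIdx_rescaledCompletion`), so the K-line class lemma
`WRow.localType_class_triple_sharp` gives the SHARP KERNEL CLASS at every member.

WHAT IS PROVED (namespace `Summit.ABC.IUTFork.Conditional`; every input BY NAME, nothing restated): §1 **`WRowM.not_licence_triple_of_not_hullCell`**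
(ONE member of pinned tame type `e₀`, `e₀·v_p(abc) = l·P`, failing cell ⟹ `¬ Thm311ToCor312.Licence` at the own-ideles M setting, ANY idele datum `r`,
every analytic `logv`, context datum, `htq0/Sq/htq1`); §2 **`WRowM.localType_class_triple_sharp`** (the sharp kernel class at every member);
§3 **`WRowM.not_licence_triple_of_hullCells_tameSharp`** (CLASS-ROBUST over the sharp class: the `hcell` hypothesis of p498814 VERBATIM — p496736's
weaker class feeds it by ignoring the two Tate clauses — NO local-type binder). The M books' binder shape is the sequel `Conditional/AbcOfSGenuineMHullCellsTriple` (file 2 of the row).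
READING (neutral; numbers, not adjectives): a sufficient condition for the M books' per-datum S_H object to FAIL at EVERY genuine datum of the class
`(ratPoint (a/c), l)`; admissibility / Szpiro-badness / (P6) / NON-EMPTINESS of the class NOT claimed. HONEST SCOPE: OUR sharp containers and
Dupuy–Hilado's typed (Ind1)/(Ind2); STRONGER-THAN-PRINT set-level reading of Step (xi-f); nothing about the printed GLOBAL inequality, the number-level
`Cor22.Cor312AtDatum` or any author's intended hull; a socket discharges nothing; typed ≠ proved; instantiated ≠ endorsed; no abc claim.
[cite: Mochizuki2012, IUTchI Def. 3.1 (b),(c),(e) pp. 61–62, Ex. 3.2 (iv) p. 67; IUTchIII Cor. 3.12 Step (xi-f) p. 184; IUTchIV Prop. 1.1 p. 9, Prop. 1.2 (i)(ii) p. 10, Cor. 2.2 (ii) proof (P5) p. 46]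
[cite: DupuyHilado2025, §3.3, §3.4, §3.9, §4.9, §4.12] [cite: NeukirchANT1999, Ch. I (8.2), Ch. II (5.5)] [cite: SerreLocalFields1979, Ch. III §6 Prop. 13]
[cite: SilvermanATAEC1994, V.5 Thm. 5.3 and Cor. 5.4] [claim: Mochizuki2012, status: disputed] for every IUT sentence.
-/

noncomputable section

open Set Function Metric NumberField IsDedekindDomain

namespace Summit.ABC.IUTFork.Conditional

open Thm311 Thm311.Real Cor312 Cor312Vol Cor312Prov Literature.IUT.LogThetaLattice Literature.IUT.LogVolume
  Literature.IUT.HodgeTheaters Literature.IUT.LogVolume.ThetaData Literature.IUT.LogVolume.Cor22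
open Literature.NumberTheory.NumberFields Literature.NumberTheory.GaloisRepresentations.Ultrametric
open Literature.NumberTheory.DiophantineGeometry Literature.NumberTheory.DiophantineGeometry.GenEll Summit.ABC.ABC.Theorems
open Summit.ABC.IUTFork.Repair.RH.HullThresholdExact

/-! ## §0. Integer glue: the hull cell is monotone in the radii -/

/-- **Monotonicity of the orders test in the radii.** If the closed-form cell FAILS with an UPPER bound `rinUb ≥ R_in` on the inner-radius exponent and a
LOWER bound `routLb ≤ R_out` on the outer-radius exponent, then the EXACT orders test of abc-iut-w5-d166 fails too:
`m < e·⌊(j²m − jD − (j+1)R_in)/e⌋ + (j+1)R_out` (floor division by `e > 0` is monotone, `j + 1 ≥ 0`). [folklore] -/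
theorem WRowM.orders_lt_of_not_hullCell {e m j D rin rout rinUb routLb : ℤ} (he : 0 < e) (hj : 0 ≤ j + 1)
    (hrin : rin ≤ rinUb) (hrout : routLb ≤ rout)
    (hneg : ¬ (e * ((j ^ 2 * m - j * D - (j + 1) * rinUb) / e) ≤ m - (j + 1) * routLb)) :
    m < e * ((m * j ^ 2 - j * D - (j + 1) * rin) / e) + (j + 1) * rout := by
  have h1 : e * ((j ^ 2 * m - j * D - (j + 1) * rinUb) / e) ≤ e * ((m * j ^ 2 - j * D - (j + 1) * rin) / e) := by
    apply mul_le_mul_of_nonneg_left _ he.le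
    apply Int.ediv_le_ediv he
    nlinarith
  have h2 : (j + 1) * routLb ≤ (j + 1) * rout := mul_le_mul_of_nonneg_left hrout hj
  rw [not_le] at hneg
  linarith

/-! ## §1. The pinned socket: ONE member of pinned tame type with a failing hull cell refutes the licence at the own-ideles M setting -/

/-- **THE HULL LICENCE FAILS AT THE OWN-IDELES M-LEVEL SETTING OF AN abc-TRIPLE DATUM WHEN R-H ROW 4's COLUMN FAILS AT A MEMBER OF PINNED TAME
TYPE.** `a + b = c` an abc triple, `l` any level, `T` a genuine Θ-volume datum at `(ratPoint (a/c), l)`, `r` ANY idele datum of `T.D`; a finite place `u`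
of `ℚ` with `p_u = p ∣ abc`, `p ≠ 2, l`; a member `x₀ ∈ V̲_u` with `e(K_{x₀}/ℚ_p) = e₀`, `p ∤ e₀`, `e₀·v_p(abc) = l·P`; a label `i + 1 ≤ (l−1)/2`; a turning
point `a₀` of `e₀`; and `¬ HullCell e₀ P (i+1) (⌊e₀/(p−1)⌋+1) (p^{a₀} − a₀·e₀)`. THEN `¬ Thm311ToCor312.Licence (settingPrVolSharpM T.D hlog (tOfIdeleData T.D r)
(tqM … r) …)` for every analytic `logv`, every context datum, any `htq0/Sq/htq1` (badness of `x₀`, `m_q = P`, exact radii with `R_in ≤ ⌊e₀/(p−1)⌋+1`,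
`R_out ≥ p^{a₀} − a₀e₀`, tame different, §0, then abc-iut-w5-d166's `not_licence_settingPrVolSharpM_tOfIdeleData_of_orders` — all BY NAME, see the header).
[cite: Mochizuki2012, IUTchI Def. 3.1 (e) p. 62, Ex. 3.2 (iv) p. 67; IUTchIII Cor. 3.12 Step (xi-f) p. 184; IUTchIV Prop. 1.1 p. 9, Prop. 1.2 (i)(ii) p. 10, Cor. 2.2 (ii) proof (P5) p. 46]
[cite: DupuyHilado2025, §3.4, §4.9, §4.12] [cite: NeukirchANT1999, Ch. II (5.5)] [cite: SerreLocalFields1979, Ch. III §6 Prop. 13] [claim: Mochizuki2012, status: disputed] -/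
theorem WRowM.not_licence_triple_of_not_hullCell {a b c l : ℕ} (habc : IsABCTriple a b c)
    (T : Cor22.ThetaVolumeDatumAt (ratPoint ((a : ℚ) / c)) l) (u : FinitePlace ℚ) (p : ℕ) (hu : ratChar u = p)
    (hp2 : p ≠ 2) (hpl : p ≠ l) (hpabc : p ∣ a * b * c) {e₀ P i a₀ : ℕ} (hpe : ¬ p ∣ e₀)
    (x₀ : letI := T.instFieldF; letI := T.instNumberFieldF; letI := T.instAlgebraF; letI := T.instFieldK
      letI := T.instNumberFieldK; letI := T.instAlgebraK; letI := T.instFieldFbar; letI := T.instAlgebraFbar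
      letI := T.instAlgebraKFbar; letI := T.instIsElliptic
      (thetaIndexOfInitial T.D).Fibre (Val.non u))
    (hloc : letI := T.instFieldF; letI := T.instNumberFieldF; letI := T.instAlgebraF; letI := T.instFieldK
      letI := T.instNumberFieldK; letI := T.instAlgebraK; letI := T.instFieldFbar; letI := T.instAlgebraFbar
      letI := T.instAlgebraKFbar; letI := T.instIsElliptic
      absRamificationIdx (ratChar u) (kOfM T.D (ratChar u) u (natCast_ratChar_mem u) x₀) = e₀)
    (hP : e₀ * (a * b * c).factorization p = l * P) (hi : i + 1 ≤ (l - 1) / 2)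
    (hlo : ∀ t : ℕ, t < a₀ → (1 : ℤ) * (p : ℤ) ^ t * ((p : ℤ) - 1) < (e₀ : ℤ))
    (hhi : (e₀ : ℤ) ≤ 1 * (p : ℤ) ^ a₀ * ((p : ℤ) - 1))
    (hneg : ¬ HullCell (e₀ : ℤ) (P : ℤ) ((i : ℤ) + 1) ((e₀ / (p - 1) + 1 : ℕ) : ℤ) ((p : ℤ) ^ a₀ - (a₀ : ℤ) * (e₀ : ℤ))) :
    letI := T.instFieldF; letI := T.instNumberFieldF; letI := T.instAlgebraF; letI := T.instFieldK
    letI := T.instNumberFieldK; letI := T.instAlgebraK; letI := T.instFieldFbar; letI := T.instAlgebraFbar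
    letI := T.instAlgebraKFbar; letI := T.instIsElliptic
    ∀ {logvK : PadicLogsVal T.K} (hlog : LogvAnalyticVal logvK) (r : ThetaData.IdeleData T.D) (M : Type) [Field M] [NumberField M]
      (archPk : ∀ (j : (thetaIndexOfInitial T.D).Label) (vQ : (thetaIndexOfInitial T.D).VQ),
        Set ((logShellsOfInitialDH T.D logvK).Packet j vQ))
      (archSub : ∀ (j : (thetaIndexOfInitial T.D).Label) (v : (thetaIndexOfInitial T.D).V),
        Set ((logShellsOfInitialDH T.D logvK).Packet j ((thetaIndexOfInitial T.D).over v)))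
      (Ψ : ℤ → ∀ v : (thetaIndexOfInitial T.D).V, v ∈ (thetaIndexOfInitial T.D).Vbad →
        Set ((logShellsOfInitialDH T.D logvK).StarPacket v))
      (act : ℤ → ∀ v : (thetaIndexOfInitial T.D).V, v ∈ (thetaIndexOfInitial T.D).Vbad →
        (logShellsOfInitialDH T.D logvK).StarPacket v → Module.End ℚ ((logShellsOfInitialDH T.D logvK).StarPacket v))
      (Mmod : ℤ → ∀ j : (thetaIndexOfInitial T.D).LabelStar, Set ((logShellsOfInitialDH T.D logvK).GlobalPacket j.1))
      (region : ℤ → ∀ j : (thetaIndexOfInitial T.D).LabelStar, FinDivisor M → ∀ vQ : (thetaIndexOfInitial T.D).VQ,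
        Set ((logShellsOfInitialDH T.D logvK).Packet j.1 vQ))
      (n : ℤ) {HT : Type} {LogLink : HT → HT → Type} {IsFull : ∀ {s t : HT}, LogLink s t → Prop}
      (lat : LGPGaussianLogThetaLattice LogLink IsFull)
      {Frd : Type} {IsoF : Frd → Frd → Type} {Ob : Frd → Type} {realify : Frd → Frd} {Strip : Type}
      {IsoS : Strip → Strip → Type}
      {Mv : ∀ v : (thetaIndexOfInitial T.D).V, v ∈ (thetaIndexOfInitial T.D).Vbad → Type} [∀ v h, Monoid (Mv v h)]
      (sig : GlobalLGPFrobenioidSignature (thetaIndexOfInitial T.D).lstar (thetaIndexOfInitial T.D).V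
        (· ∈ (thetaIndexOfInitial T.D).Vbad) Frd IsoF Ob realify Strip IsoS Mv)
      (split : SplittingMonoids Mv) {ObΔ : Type}
      {N : ∀ v : (thetaIndexOfInitial T.D).V, v ∈ (thetaIndexOfInitial T.D).Vbad → Type} [∀ v h, Monoid (N v h)]
      (qData : QPilotData ObΔ N)
      (htq0 : ∀ (u : FinitePlace ℚ) (x : (thetaIndexOfInitial T.D).Fibre (Val.non u)),
        tqM T.D (ratChar u) u (natCast_ratChar_mem u) r x ≠ 0)
      (Sq : Finset (FinitePlace ℚ))
      (htq1 : ∀ (u : FinitePlace ℚ) (x : (thetaIndexOfInitial T.D).Fibre (Val.non u)), u ∉ Sq →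
        ‖tqM T.D (ratChar u) u (natCast_ratChar_mem u) r x‖ = 1),
      ¬ Thm311ToCor312.Licence
        (settingPrVolSharpM T.D hlog (tOfIdeleData T.D r) (fun u x => tqM T.D (ratChar u) u (natCast_ratChar_mem u) r x) M archPk
          archSub Ψ act Mmod region n lat sig split qData htq0 Sq htq1) := by
  classical
  letI := T.instFieldF; letI := T.instNumberFieldF; letI := T.instAlgebraF; letI := T.instFieldK
  letI := T.instNumberFieldK; letI := T.instAlgebraK; letI := T.instFieldFbar; letI := T.instAlgebraFbar
  letI := T.instAlgebraKFbar; letI := T.instIsElliptic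
  intro logvK hlog r M _ _ archPk archSub Ψ act Mmod region n HT LogLink IsFull lat Frd IsoF Ob realify Strip IsoS Mv _ sig split ObΔ N _
    qData htq0 Sq htq1
  subst hu
  haveI hpfact : Fact (ratChar u).Prime := inferInstance
  have hp : (ratChar u).Prime := hpfact.out
  set K₀ := kOfM T.D (ratChar u) u (natCast_ratChar_mem u) x₀ with hK₀
  -- numerics
  have hp1 : 1 < ratChar u := hp.one_lt
  have hq0 : 0 < ratChar u - 1 := by omega
  have hp1r : (1 : ℝ) < ((ratChar u : ℕ) : ℝ) := by exact_mod_cast hp1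
  have hp0r : (0 : ℝ) < ((ratChar u : ℕ) : ℝ) := by linarith
  have ha : 0 < a := habc.1
  have hb : 0 < b := habc.2.1
  have hc : 0 < c := by have := habc.2.2.1; omega
  have habc0 : a * b * c ≠ 0 := by positivity
  set v : ℕ := (a * b * c).factorization (ratChar u) with hvdef
  have hv : 0 < v := Nat.Prime.factorization_pos_of_dvd hp habc0 hpabc
  have hl5 : 5 ≤ l := T.D.five_le_l
  have hlstar : (thetaIndexOfInitial T.D).lstar = (l - 1) / 2 := rfl
  have hil : i < (thetaIndexOfInitial T.D).lstar := by rw [hlstar]; omega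
  -- the local type at the member
  have he0 : 0 < e₀ := by rw [← hloc]; exact absRamificationIdx_pos (ratChar u) _
  have he0r : (0 : ℝ) < (e₀ : ℝ) := by exact_mod_cast he0
  have htame : ¬ ratChar u ∣ absRamificationIdx (ratChar u) K₀ := by rw [hloc]; exact hpe
  -- the pole of `j(a/c)` below `u`, and the badness of the member
  have hjF : T.E.j = ((jInv ((a : ℚ) / c) : ℚ) : T.F) := by rw [T.j_eq]; exact eq_ratCast _ _
  have hpole : ∀ w : HeightOneSpectrum (𝓞 ℚ), Rat.HeightOneSpectrum.natGenerator w = ratChar u →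
      ord ℚ w (jInv ((a : ℚ) / c)) = -(2 * ((v : ℕ) : ℤ)) := by
    intro w hw
    rw [Cor22.ord_jInv_ratPoint_triple_eq habc w (by rw [hw]; exact hp2) (by rw [hw]; exact hpabc), hw]
  have hord : ∀ w : HeightOneSpectrum (𝓞 ℚ), Rat.HeightOneSpectrum.natGenerator w = ratChar u →
      ord ℚ w (Cor22.jInv ((a : ℚ) / c)) ≤ -((1 : ℕ) : ℤ) := by
    intro w hw
    rw [hpole w hw]
    have : (0 : ℤ) < v := by exact_mod_cast hv
    push_cast
    linarith
  obtain ⟨hS, -⟩ := placeModOfM_mem_S_and_norm_tqM_le_of_ratPoint T.D (ratChar u) u (natCast_ratChar_mem u) r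
    ((a : ℚ) / c) T.j_eq T.isP5Choice x₀ hp2 hpl 1 le_rfl hord
  -- a norm uniformiser of `K_{x₀}` and the integer order `m_q` of the q-idele; its value `m_q = P`
  obtain ⟨ϖ, hϖ, -⟩ := exists_isUniformizer_rescaledCompletion T.K (ratChar u) (placeOfM T.D u x₀)
    (natCast_mem_placeOfM T.D (ratChar u) u (natCast_ratChar_mem u) x₀)
  obtain ⟨mq, hmq⟩ := exists_int_norm_tqM_eq_zpow T.D (ratChar u) u (natCast_ratChar_mem u) r x₀ hϖ
  have hval := two_mul_l_mul_order_tqM_eq_of_j_eq T.D (ratChar u) u (natCast_ratChar_mem u) r x₀ hS (jInv ((a : ℚ) / c)) hjF hϖ hmq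
  have hordu := hpole _ (natGenerator_finBelow_placeModOfM T.D (ratChar u) u (natCast_ratChar_mem u) x₀)
  have hmqP : mq = (P : ℤ) := by
    rw [hordu] at hval
    change (2 * l : ℤ) * mq = -(absRamificationIdx (ratChar u) K₀ : ℤ) * -(2 * ((v : ℕ) : ℤ)) at hval
    rw [hloc] at hval
    have hPZ : ((e₀ : ℤ)) * (v : ℤ) = (l : ℤ) * (P : ℤ) := by exact_mod_cast hP
    have hl0 : (0 : ℤ) < 2 * (l : ℤ) := by
      have : (0 : ℤ) < (l : ℤ) := by exact_mod_cast (show 0 < l by omega)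
      linarith
    have h2 : (2 * l : ℤ) * mq = (2 * l : ℤ) * (P : ℤ) := by
      rw [hval]; linear_combination (2 : ℤ) * hPZ
    exact mul_left_cancel₀ hl0.ne' h2
  -- the EXACT inner and outer radii of `log_p(𝒪^×_{K_{x₀}})`, with their integer exponents
  obtain ⟨cin, ϖ', w, hcin0, hin, hϖ', hw, hwle⟩ := HexHullThreshold.exists_innerRadius (ratChar u) K₀
  obtain ⟨cout, houtΛ, hcout0, hdom⟩ := HexHullThreshold.exists_outerRadius (ratChar u) K₀
  obtain ⟨Rin, hRin⟩ := hϖ.2 (Units.mk0 cin hcin0)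
  obtain ⟨Rout, hRout⟩ := hϖ.2 (Units.mk0 cout hcout0)
  rw [Units.val_mk0] at hRin hRout
  have hϖnorm : ‖(ϖ : K₀)‖ = ((ratChar u : ℕ) : ℝ) ^ (-(1 / (e₀ : ℝ))) := by
    rw [norm_eq_rpow_of_isUniformizer (ratChar u) K₀ hϖ, hloc]
  have hzpow : ∀ m : ℤ, ‖(ϖ : K₀)‖ ^ m = ((ratChar u : ℕ) : ℝ) ^ (-((m : ℝ) / (e₀ : ℝ))) := by
    intro m
    rw [hϖnorm, ← Real.rpow_intCast, ← Real.rpow_mul hp0r.le]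
    congr 1
    ring
  -- `R_in ≤ ⌊e₀/(p−1)⌋ + 1`
  have hRinle : Rin ≤ ((e₀ / (ratChar u - 1) + 1 : ℕ) : ℤ) := by
    have hr : 1 / (((ratChar u : ℕ) : ℝ) - 1) < ((((e₀ / (ratChar u - 1) + 1 : ℕ) : ℤ)) : ℝ) /
        (absRamificationIdx (ratChar u) K₀ : ℝ) := by
      rw [hloc]
      have hq : e₀ < (ratChar u - 1) * (e₀ / (ratChar u - 1) + 1) := Nat.lt_mul_div_succ e₀ hq0
      have hqr : (e₀ : ℝ) < (((ratChar u - 1 : ℕ)) : ℝ) * (((e₀ / (ratChar u - 1) + 1 : ℕ)) : ℝ) := by exact_mod_cast hq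
      have hsub : (((ratChar u - 1 : ℕ)) : ℝ) = ((ratChar u : ℕ) : ℝ) - 1 := by
        rw [Nat.cast_sub hp1.le, Nat.cast_one]
      rw [hsub] at hqr
      have hq0r : (0 : ℝ) < ((ratChar u : ℕ) : ℝ) - 1 := by linarith
      rw [lt_div_iff₀ he0r, one_div, inv_mul_lt_iff₀ hq0r]
      simp only [Int.cast_natCast]
      exact hqr
    have h := HexHullThreshold.rpow_le_norm_of_innerRadius (ratChar u) K₀ hϖ' hw hwle hr
    rw [hloc, hRin, hzpow] at h
    have h' := (Real.rpow_le_rpow_left_iff hp1r).mp h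
    rw [neg_le_neg_iff, div_le_div_iff_of_pos_right he0r] at h'
    exact_mod_cast h'
  -- `R_out ≥ p^{a₀} − a₀·e₀`
  have hRoutge : ((ratChar u : ℕ) : ℤ) ^ a₀ - (a₀ : ℤ) * (e₀ : ℤ) ≤ Rout := by
    have hlo' : ∀ t < a₀, (1 : ℤ) * ((ratChar u : ℕ) : ℤ) ^ t * ((((ratChar u : ℕ)) : ℤ) - 1) <
        absRamificationIdx (ratChar u) K₀ := by rw [hloc]; exact fun t ht => hlo t ht
    have hhi' : (absRamificationIdx (ratChar u) K₀ : ℤ) ≤ 1 * (((ratChar u : ℕ)) : ℤ) ^ a₀ * ((((ratChar u : ℕ)) : ℤ) - 1) := by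
      rw [hloc]; exact hhi
    have h := HexHullThreshold.norm_le_rpow_of_mem_logUnits_turning (ratChar u) K₀ hlo' hhi' houtΛ
    rw [hloc, hRout, hzpow] at h
    have h' := (Real.rpow_le_rpow_left_iff hp1r).mp h
    push_cast at h'
    rw [neg_div, neg_le_neg_iff, div_le_div_iff_of_pos_right he0r] at h'
    exact_mod_cast h'
  -- the tame different `(e₀ − 1)/e₀`
  have hD : differentOrd (ratChar u) K₀ = (((e₀ - 1 : ℕ)) : ℝ) / absRamificationIdx (ratChar u) K₀ := by
    rw [differentOrd_eq_of_not_dvd (ratChar u) K₀ htame, hloc, Nat.cast_sub he0, Nat.cast_one]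
  -- the integer test of abc-iut-w5-d166 fails at `(u, i, x₀)`
  have hlt : mq < (absRamificationIdx (ratChar u) K₀ : ℤ) *
        ((mq * ((((i : ℕ) + 1) ^ 2 : ℕ) : ℤ) - ((i : ℕ) + 1 : ℕ) * (((e₀ - 1 : ℕ)) : ℤ) - ((i : ℕ) + 2 : ℕ) * Rin) /
          (absRamificationIdx (ratChar u) K₀ : ℤ)) + ((i : ℕ) + 2 : ℕ) * Rout := by
    rw [hloc, hmqP]
    have he0Z : (0 : ℤ) < (e₀ : ℤ) := by exact_mod_cast he0
    have hcell := WRowM.orders_lt_of_not_hullCell (m := (P : ℤ)) (j := (i : ℤ) + 1) (D := (e₀ : ℤ) - 1) he0Z (by positivity)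
      hRinle hRoutge (by unfold HullCell at hneg; exact hneg)
    have hsub : (((e₀ - 1 : ℕ)) : ℤ) = (e₀ : ℤ) - 1 := by rw [Nat.cast_sub he0, Nat.cast_one]
    rw [hsub]
    push_cast
    have hj2 : ((i : ℤ) + 2) = ((i : ℤ) + 1) + 1 := by ring
    rw [hj2]
    convert hcell using 3
  exact not_licence_settingPrVolSharpM_tOfIdeleData_of_orders T.D hlog r M archPk archSub Ψ act Mmod region n lat sig split qData htq0 Sq
    htq1 u ⟨i, hil⟩ x₀ hϖ hD hin ⟨ϖ', w, hϖ', hw, hwle⟩ houtΛ hdom hRin hRout hmq hlt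

/-! ## §2. The SHARP kernel class of the local type at a member over a tame pole -/

/-- **The SHARP KERNEL CLASS at the M-line members.** `a + b = c` coprime, `T` a genuine Θ-volume datum at `(ratPoint (a/c), l)`, `u` a finite
place of `ℚ` with `p_u = p ∣ abc`, `p ∉ {2, 3, 5, l}`, `v := v_p(abc)`. Then EVERY member `x₀ ∈ V̲_u` has `e(K_{x₀}/ℚ_p) = A·l` with `A ∣ 30`,
`15 ∣ A·v`, (`v` even ⇒ `A ∣ 15`), (`3 ∣ v` ⇒ `A ∣ 10`), (`5 ∣ v` ⇒ `A ∣ 6`) and `p ∤ A·l`: the member sits on a place `w = placeOfM x₀` of `K`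
over `p`, which IS the place of a K-fibre point `x'` (`fibreEquivPlacesOver`), and `e(K_{x₀}/ℚ_p) = e(w | p) = e(K_{x'}/ℚ_p)`
(`absRamificationIdx_rescaledCompletion`, abc-iut-C-cert-2's transfer) — so this seat's K-line `WRow.localType_class_triple_sharp` applies verbatim.
[cite: Serre1972, §1.11–§1.12] [cite: SilvermanATAEC1994, V.5 Thm. 5.3 and Cor. 5.4] [cite: Mochizuki2012, IUTchIV Thm. 1.10 p. 22 and proof Steps (ii)–(iii) p. 24–26]
[claim: Mochizuki2012, status: disputed] -/
theorem WRowM.localType_class_triple_sharp {a b c l : ℕ} (habc : IsABCTriple a b c)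
    (T : Cor22.ThetaVolumeDatumAt (ratPoint ((a : ℚ) / c)) l) (u : FinitePlace ℚ) (p : ℕ) (hu : ratChar u = p)
    (hp2 : p ≠ 2) (hp3 : p ≠ 3) (hp5 : p ≠ 5) (hpl : p ≠ l) (hpabc : p ∣ a * b * c) {v : ℕ} (hv : (a * b * c).factorization p = v) :
    letI := T.instFieldF; letI := T.instNumberFieldF; letI := T.instAlgebraF; letI := T.instFieldK
    letI := T.instNumberFieldK; letI := T.instAlgebraK; letI := T.instFieldFbar; letI := T.instAlgebraFbar
    letI := T.instAlgebraKFbar; letI := T.instIsElliptic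
    ∀ x₀ : (thetaIndexOfInitial T.D).Fibre (Val.non u),
      ∃ A : ℕ, absRamificationIdx (ratChar u) (kOfM T.D (ratChar u) u (natCast_ratChar_mem u) x₀) = A * l ∧
        A ∣ 30 ∧ 15 ∣ A * v ∧ (Even v → A ∣ 15) ∧ (3 ∣ v → A ∣ 10) ∧ (5 ∣ v → A ∣ 6) ∧ ¬ p ∣ A * l := by
  classical
  letI := T.instFieldF; letI := T.instNumberFieldF; letI := T.instAlgebraF; letI := T.instFieldK
  letI := T.instNumberFieldK; letI := T.instAlgebraK; letI := T.instFieldFbar; letI := T.instAlgebraFbar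
  letI := T.instAlgebraKFbar; letI := T.instIsElliptic
  intro x₀
  subst hu
  haveI hpfact : Fact (ratChar u).Prime := inferInstance
  set X := pilotDataOfK T.D T.K with hX
  set pp : Nat.Primes := ⟨ratChar u, hpfact.out⟩ with hpp
  -- the K-fibre point on the place of the member
  obtain ⟨x', hx'⟩ : ∃ x' : (thetaIndex X).Fibre (.inr pp), placeOf X (ratChar u) x' = placeOfM T.D u x₀ := by
    refine ⟨(fibreEquivPlacesOver X pp).symm
      ⟨placeOfM T.D u x₀, placeOfM_mem_placesOver T.D (ratChar u) u (natCast_ratChar_mem u) x₀⟩, ?_⟩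
    show (fibreEquivPlacesOver X pp ((fibreEquivPlacesOver X pp).symm _)).1 = _
    rw [Equiv.apply_symm_apply]
  have heK : absRamificationIdx (pp : ℕ) (kOf X pp.1 x') = absRamificationIdx (ratChar u) (kOfM T.D (ratChar u) u (natCast_ratChar_mem u) x₀) := by
    show absRamificationIdx (ratChar u) (kOf X (ratChar u) x') = _
    rw [absRamificationIdx_rescaledCompletion, absRamificationIdx_rescaledCompletion, hx']
  obtain ⟨A, hA, h30, h15, hpar, h3, h5, hpe⟩ := WRow.localType_class_triple_sharp habc T pp hp2 hp3 hp5 hpl hpabc hv x'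
  exact ⟨A, heK ▸ hA, h30, h15, hpar, h3, h5, hpe⟩

/-! ## §3. The class-robust socket: failing cells for every class member refute the licence, with NO local-type hypothesis -/

/-- **THE HULL LICENCE FAILS AT THE OWN-IDELES M-LEVEL SETTING OF AN abc-TRIPLE DATUM WHEN R-H ROW 4's COLUMN FAILS AT A TAME POLE FOR EVERY MEMBER
OF THE SHARP KERNEL CLASS OF LOCAL TYPES** — the M twin of this seat's `WRow.not_licence_triple_of_hullCells_tameSharp` (p498814; and of `…_tame`
p496736, whose weaker class hypothesis feeds this one by ignoring the two Tate clauses), SAME `hcell` hypothesis VERBATIM: `a + b = c` an abc triple,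
`l` any level, `T` a genuine Θ-volume datum at `(ratPoint (a/c), l)`, ANY idele datum `r`; a finite place `u` of `ℚ` with `p_u = p ∣ abc`, `p ∉ {2, 3, 5, l}`,
`v := v_p(abc)`; a label `i + 1 ≤ (l−1)/2`; and for EVERY `A` with `A ∣ 30`, `15 ∣ A·v`, (`v` even ⇒ `A ∣ 15`), (`3 ∣ v` ⇒ `A ∣ 10`), (`5 ∣ v` ⇒ `A ∣ 6`)
a turning point `a₀` of `A·l` with `¬ HullCell (A·l) (A·v) (i+1) (⌊A·l/(p−1)⌋+1) (p^{a₀} − a₀·A·l)`. THEN `¬ Thm311ToCor312.Licence` at the own-ideles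
M setting (every analytic `logv`, context datum, `htq0/Sq/htq1`): the fibre `V̲_u` is non-empty, the type of a member lies in the class (§2), and §1
applies with `(e₀, P) = (A·l, A·v)`. [cite: Mochizuki2012, IUTchI Ex. 3.2 (iv) p. 67; IUTchIII Cor. 3.12 Step (xi-f) p. 184; IUTchIV Prop. 1.1 p. 9,
Prop. 1.2 (i)(ii) p. 10, Cor. 2.2 (ii) proof (P5) p. 46] [cite: DupuyHilado2025, §3.4, §4.9, §4.12] [cite: SerreLocalFields1979, Ch. III §6 Prop. 13]
[claim: Mochizuki2012, status: disputed] -/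
theorem WRowM.not_licence_triple_of_hullCells_tameSharp {a b c l : ℕ} (habc : IsABCTriple a b c)
    (T : Cor22.ThetaVolumeDatumAt (ratPoint ((a : ℚ) / c)) l) (u : FinitePlace ℚ) (p : ℕ) (hu : ratChar u = p)
    (hp2 : p ≠ 2) (hp3 : p ≠ 3) (hp5 : p ≠ 5) (hpl : p ≠ l) (hpabc : p ∣ a * b * c) {v : ℕ} (hv : (a * b * c).factorization p = v)
    {i : ℕ} (hi : i + 1 ≤ (l - 1) / 2)
    (hcell : ∀ A : ℕ, A ∣ 30 → 15 ∣ A * v → (Even v → A ∣ 15) → (3 ∣ v → A ∣ 10) → (5 ∣ v → A ∣ 6) →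
      ∃ a₀ : ℕ, (∀ s : ℕ, s < a₀ → (1 : ℤ) * (p : ℤ) ^ s * ((p : ℤ) - 1) < ((A * l : ℕ) : ℤ)) ∧
        ((A * l : ℕ) : ℤ) ≤ 1 * (p : ℤ) ^ a₀ * ((p : ℤ) - 1) ∧
        ¬ HullCell ((A * l : ℕ) : ℤ) ((A * v : ℕ) : ℤ) ((i : ℤ) + 1) (((A * l) / (p - 1) + 1 : ℕ) : ℤ)
          ((p : ℤ) ^ a₀ - (a₀ : ℤ) * ((A * l : ℕ) : ℤ))) :
    letI := T.instFieldF; letI := T.instNumberFieldF; letI := T.instAlgebraF; letI := T.instFieldK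
    letI := T.instNumberFieldK; letI := T.instAlgebraK; letI := T.instFieldFbar; letI := T.instAlgebraFbar
    letI := T.instAlgebraKFbar; letI := T.instIsElliptic
    ∀ {logvK : PadicLogsVal T.K} (hlog : LogvAnalyticVal logvK) (r : ThetaData.IdeleData T.D) (M : Type) [Field M] [NumberField M]
      (archPk : ∀ (j : (thetaIndexOfInitial T.D).Label) (vQ : (thetaIndexOfInitial T.D).VQ),
        Set ((logShellsOfInitialDH T.D logvK).Packet j vQ))
      (archSub : ∀ (j : (thetaIndexOfInitial T.D).Label) (v : (thetaIndexOfInitial T.D).V),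
        Set ((logShellsOfInitialDH T.D logvK).Packet j ((thetaIndexOfInitial T.D).over v)))
      (Ψ : ℤ → ∀ v : (thetaIndexOfInitial T.D).V, v ∈ (thetaIndexOfInitial T.D).Vbad →
        Set ((logShellsOfInitialDH T.D logvK).StarPacket v))
      (act : ℤ → ∀ v : (thetaIndexOfInitial T.D).V, v ∈ (thetaIndexOfInitial T.D).Vbad →
        (logShellsOfInitialDH T.D logvK).StarPacket v → Module.End ℚ ((logShellsOfInitialDH T.D logvK).StarPacket v))
      (Mmod : ℤ → ∀ j : (thetaIndexOfInitial T.D).LabelStar, Set ((logShellsOfInitialDH T.D logvK).GlobalPacket j.1))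
      (region : ℤ → ∀ j : (thetaIndexOfInitial T.D).LabelStar, FinDivisor M → ∀ vQ : (thetaIndexOfInitial T.D).VQ,
        Set ((logShellsOfInitialDH T.D logvK).Packet j.1 vQ))
      (n : ℤ) {HT : Type} {LogLink : HT → HT → Type} {IsFull : ∀ {s t : HT}, LogLink s t → Prop}
      (lat : LGPGaussianLogThetaLattice LogLink IsFull)
      {Frd : Type} {IsoF : Frd → Frd → Type} {Ob : Frd → Type} {realify : Frd → Frd} {Strip : Type}
      {IsoS : Strip → Strip → Type}
      {Mv : ∀ v : (thetaIndexOfInitial T.D).V, v ∈ (thetaIndexOfInitial T.D).Vbad → Type} [∀ v h, Monoid (Mv v h)]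
      (sig : GlobalLGPFrobenioidSignature (thetaIndexOfInitial T.D).lstar (thetaIndexOfInitial T.D).V
        (· ∈ (thetaIndexOfInitial T.D).Vbad) Frd IsoF Ob realify Strip IsoS Mv)
      (split : SplittingMonoids Mv) {ObΔ : Type}
      {N : ∀ v : (thetaIndexOfInitial T.D).V, v ∈ (thetaIndexOfInitial T.D).Vbad → Type} [∀ v h, Monoid (N v h)]
      (qData : QPilotData ObΔ N)
      (htq0 : ∀ (u : FinitePlace ℚ) (x : (thetaIndexOfInitial T.D).Fibre (Val.non u)),
        tqM T.D (ratChar u) u (natCast_ratChar_mem u) r x ≠ 0)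
      (Sq : Finset (FinitePlace ℚ))
      (htq1 : ∀ (u : FinitePlace ℚ) (x : (thetaIndexOfInitial T.D).Fibre (Val.non u)), u ∉ Sq →
        ‖tqM T.D (ratChar u) u (natCast_ratChar_mem u) r x‖ = 1),
      ¬ Thm311ToCor312.Licence
        (settingPrVolSharpM T.D hlog (tOfIdeleData T.D r) (fun u x => tqM T.D (ratChar u) u (natCast_ratChar_mem u) r x) M archPk
          archSub Ψ act Mmod region n lat sig split qData htq0 Sq htq1) := by
  classical
  letI := T.instFieldF; letI := T.instNumberFieldF; letI := T.instAlgebraF; letI := T.instFieldK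
  letI := T.instNumberFieldK; letI := T.instAlgebraK; letI := T.instFieldFbar; letI := T.instAlgebraFbar
  letI := T.instAlgebraKFbar; letI := T.instIsElliptic
  intro logvK hlog r M _ _ archPk archSub Ψ act Mmod region n HT LogLink IsFull lat Frd IsoF Ob realify Strip IsoS Mv _ sig split ObΔ N _
    qData htq0 Sq htq1
  obtain ⟨y, hy⟩ := (thetaIndexOfInitial T.D).fibre_nonempty (Val.non u)
  obtain ⟨A, hA, h30, h15, hpar, h3, h5, hpe⟩ := WRowM.localType_class_triple_sharp habc T u p hu hp2 hp3 hp5 hpl hpabc hv ⟨y, hy⟩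
  obtain ⟨a₀, hlo, hhi, hneg⟩ := hcell A h30 h15 hpar h3 h5
  have hpe' : ¬ p ∣ A * l := hpe
  exact WRowM.not_licence_triple_of_not_hullCell habc T u p hu hp2 hpl hpabc (e₀ := A * l) (P := A * v) (i := i) (a₀ := a₀) hpe'
    ⟨y, hy⟩ hA (by rw [hv]; ring) hi hlo hhi hneg hlog r M archPk archSub Ψ act Mmod region n lat sig split qData htq0 Sq htq1

end Summit.ABC.IUTFork.Conditional

end
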